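import Summits.QuantumFields.YangMills.Theorems.FluctuationComparisonRegPrIntLS2BetaTreeGaugeChart
import Summits.QuantumFields.YangMills.Theorems.FluctuationComparisonRegPrIntLS2BetaSignedCombCount
import HarnessLib

/-!
# (C3-d) THE TUBULAR HAAR CHART OF THE SIGNED COMB OFF THE PIVOTS

Crux `stmt-QuantumFields-20520` (`…Theses.UnitScaleTilt.FluctuationComparisonRegPrIntL`), LINE g18-1 S2β LAPLACE, organ (C3) «tubular Haar
coordinates around a residual-gauge orbit».  The generic tree-gauge chart `…S2BetaTreeGaugeChart.exists_tubularChart_of_treeGauge` (p736010) is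
INSTANTIATED on the off-pivot bonds of the fine torus:

* sites `ι = Site P 0`, bonds `β′ = {b : PBond P 0 // b ∉ range (iterCentralBond k)}` (the pivots `βₖ(c)` of `…WregChain` removed), `s∕t` = source ∕ target;
* roots `R = range (embIter k)` (the `k`-centres), comb `F′ = {b : β′ | b.1 ∈ combSet k}` (the signed in-block comb of (C3-c) II);
* tree gauge `g V′ := combTransporter k (V′ extended by 1 on the pivots)` ((C3-c) I).

The six tree-gauge axioms are discharged BY NAME: `hgc` ← `continuous_combTransporter`; `hgR` ← `combTransporter_embIter`; `hcov` ←
`combTransporter_gaugeAct_of_rootTrivial` + `combTransporter_congr` + `iterCentralBond_not_mem_combSet` (a gauge transformation of the extended field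
differs from the extension of the gauged field only ON the pivots, which are not comb bonds); `hkill` ← `combTransporter_kill`; `hloc` ←
`combTransporter_congr`; `hg1` ← `combTransporter_one`.  Result: `exists_tubularChart_offPivot` — the (C3β″) letter's residual factor and transversal,
with product Haar on `β′ → G`; the pivot factor (a plain translated exponential frame) and the Euclidean re-indexing are (C3-e).
[cite: Balaban1985Variational, (19) p.281, (181) p.307; Balaban1985Averaging, (8), (10) p.18; Helgason2000, Ch. I §1 Thm 1.14 (13) p.96]
-/

noncomputable section

open MeasureTheory MeasureTheory.Measure Set Function Filter Topology
open scoped ENNReal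
open Literature.MathematicalPhysics.QuantumFieldTheory.Balaban1983to89
open Literature.MathematicalPhysics.QuantumFieldTheory.Balaban1983to89.HaarExponentialChart
open Literature.MathematicalPhysics.QuantumFieldTheory.Balaban1983to89.LogChartProduct
open Literature.MathematicalPhysics.QuantumFieldTheory.Balaban1983to89.T4RootedResidualGauge (rootOf rootOf_embIter)
open Literature.MathematicalPhysics.QuantumFieldTheory.Balaban1983to89.B15DeterminingSets (embIter)
open Literature.MathematicalPhysics.QuantumFieldTheory.Balaban1983to89.GaugeField (gaugeAct)
open Summit.QuantumFields.YangMills.Theorems.FluctuationComparisonRegPrIntLWregChain (iterCentralBond)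
open Summit.QuantumFields.YangMills.Theorems.FluctuationComparisonRegPrIntLS2BetaTreeGaugeChart
open Summit.QuantumFields.YangMills.Theorems.FluctuationComparisonRegPrIntLS2BetaSignedComb
open Summit.QuantumFields.YangMills.Theorems.FluctuationComparisonRegPrIntLS2BetaSignedCombKill
open Summit.QuantumFields.YangMills.Theorems.FluctuationComparisonRegPrIntLS2BetaSignedCombCount

namespace Summit.QuantumFields.YangMills.Theorems.FluctuationComparisonRegPrIntLS2BetaTreeGaugeOffPivot

variable {G : Type*} [GaugeGroup G] (P : Params) {k : ℕ}

/-! ## §1  Extension by `1` on the pivots and the off-pivot tree gauge -/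

/-- On the comb bonds the extension of a gauged off-pivot field is the gauge transform of the extension (comb bonds are not pivots).
[cite: Balaban1985Variational, (19) p.281 (bookkeeping)] -/
theorem ext_gauge_eq_on_combSet (hk : k ≤ P.m + P.K) (a : Site P 0 → G)
    (V' : {b : PBond P 0 // b ∉ Set.range (iterCentralBond (P := P) k)} → G) :
    ∀ b ∈ (combSet k : Set (PBond P 0)),
      (fun b : PBond P 0 => if hb : b ∈ Set.range (iterCentralBond (P := P) k) then (1 : G)
        else (fun b' : {b : PBond P 0 // b ∉ Set.range (iterCentralBond (P := P) k)} => a b'.1.src * V' b' * (a b'.1.tgt)⁻¹) ⟨b, hb⟩) b =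
      gaugeAct a (fun b : PBond P 0 => if hb : b ∈ Set.range (iterCentralBond (P := P) k) then (1 : G) else V' ⟨b, hb⟩) b := by
  intro b hbF
  have hb : b ∉ Set.range (iterCentralBond (P := P) k) := fun ⟨c, hc⟩ => iterCentralBond_not_mem_combSet hk c (hc ▸ hbF)
  simp only [gaugeAct, dif_neg hb]

/-! ## §2  The chart -/

variable {𝔸 : Type*} [NormedRing 𝔸] [NormedAlgebra ℂ 𝔸] [CompleteSpace 𝔸]
variable [TopologicalSpace G] [IsTopologicalGroup G] [CompactSpace G] [T2Space G] [MeasurableSpace G] [BorelSpace G] [SecondCountableTopology G]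
variable {C : LogChart 𝔸} {ρ : G →* 𝔸} (h : IsChartRep C ρ) [FiniteDimensional ℝ C.lie]
  (hlie : ∀ x ∈ C.lie, ∀ y ∈ C.lie, x * y - y * x ∈ C.lie)
variable (μG : Measure G) [μG.IsHaarMeasure] [IsProbabilityMeasure μG]

include h hlie in
open Classical in
/-- ★★★ **THE TUBULAR HAAR CHART OF THE SIGNED COMB OFF THE PIVOTS**: the generic tree-gauge chart instantiated on the off-pivot bonds of `T_η` with the
`k`-centres as roots, the signed in-block comb as the killed set and `combTransporter k` as the tree gauge.  For every off-pivot configuration `U₀` there are a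
ROOT-TRIVIAL (= residual) group chart `e` around `1`, locally onto the residual transformations near `1`, a transversal `σ` through `U₀`, an open window
`W ∋ 0` on which `(z, y) ↦ e(z) • σ(y)` is injective and open at the origin, and a continuous density `J ≥ 0`, `J(0) > 0`, with
`(⊗_{β′} μG)|_{image} = Θ_*((J · vol ⊗ vol)|_W)`. [cite: Balaban1985Variational, (19) p.281, (181) p.307; Balaban1985Averaging, (8), (10) p.18;
Helgason2000, Ch. I §1 Thm 1.14 (13) p.96] -/
theorem exists_tubularChart_offPivot (hk : k ≤ P.m + P.K)
    {Z : Type*} [NormedAddCommGroup Z] [InnerProductSpace ℝ Z] [FiniteDimensional ℝ Z] [MeasurableSpace Z] [BorelSpace Z]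
    (eZ : Z ≃L[ℝ] (piLogChart C {x : Site P 0 // x ∉ Set.range (embIter k : Site P k → Site P 0)}).lie)
    {V : Type*} [NormedAddCommGroup V] [InnerProductSpace ℝ V] [FiniteDimensional ℝ V] [MeasurableSpace V] [BorelSpace V]
    (eV : V ≃L[ℝ] (piLogChart C {b : {b : PBond P 0 // b ∉ Set.range (iterCentralBond (P := P) k)} //
      b ∉ {b' : {b : PBond P 0 // b ∉ Set.range (iterCentralBond (P := P) k)} | b'.1 ∈ (combSet k : Set (PBond P 0))}}).lie)
    (U₀ : {b : PBond P 0 // b ∉ Set.range (iterCentralBond (P := P) k)} → G) :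
    ∃ (e : Z → (Site P 0 → G)) (σ : V → ({b : PBond P 0 // b ∉ Set.range (iterCentralBond (P := P) k)} → G)) (W : Set (Z × V))
      (J : Z × V → ℝ),
      Continuous e ∧ e 0 = 1 ∧ (∀ z, ∀ r ∈ Set.range (embIter k : Site P k → Site P 0), e z r = 1) ∧
      (∀ sZ ∈ 𝓝 (0 : Z), ∃ tt ∈ 𝓝 (1 : Site P 0 → G), ∀ w ∈ tt,
        (∀ r ∈ Set.range (embIter k : Site P k → Site P 0), w r = 1) → w ∈ e '' sZ) ∧
      Continuous σ ∧ σ 0 = U₀ ∧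
      IsOpen W ∧ ((0 : Z), (0 : V)) ∈ W ∧
      InjOn (fun p : Z × V => fun b : {b : PBond P 0 // b ∉ Set.range (iterCentralBond (P := P) k)} =>
        e p.1 b.1.src * σ p.2 b * (e p.1 b.1.tgt)⁻¹) W ∧
      (∀ sW ∈ 𝓝 ((0 : Z), (0 : V)), (fun p : Z × V => fun b : {b : PBond P 0 // b ∉ Set.range (iterCentralBond (P := P) k)} =>
        e p.1 b.1.src * σ p.2 b * (e p.1 b.1.tgt)⁻¹) '' sW ∈ 𝓝 U₀) ∧
      ContinuousOn J W ∧ (∀ w ∈ W, 0 ≤ J w) ∧ 0 < J (0, 0) ∧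
      (Measure.pi fun _ : {b : PBond P 0 // b ∉ Set.range (iterCentralBond (P := P) k)} => μG).restrict
          ((fun p : Z × V => fun b : {b : PBond P 0 // b ∉ Set.range (iterCentralBond (P := P) k)} =>
            e p.1 b.1.src * σ p.2 b * (e p.1 b.1.tgt)⁻¹) '' W) =
        ((((volume : Measure Z).prod (volume : Measure V)).restrict W).withDensity (fun w => ENNReal.ofReal (J w))).map
          (fun p : Z × V => fun b : {b : PBond P 0 // b ∉ Set.range (iterCentralBond (P := P) k)} =>
            e p.1 b.1.src * σ p.2 b * (e p.1 b.1.tgt)⁻¹) := by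
  classical
  -- Borel structures on the two Lie factors (only used inside the generic chart)
  letI : MeasurableSpace (piLogChart C {x : Site P 0 // x ∉ Set.range (embIter k : Site P k → Site P 0)}).lie := borel _
  haveI : BorelSpace (piLogChart C {x : Site P 0 // x ∉ Set.range (embIter k : Site P k → Site P 0)}).lie := ⟨rfl⟩
  letI : MeasurableSpace (piLogChart C {b : {b : PBond P 0 // b ∉ Set.range (iterCentralBond (P := P) k)} //
      b ∉ {b' : {b : PBond P 0 // b ∉ Set.range (iterCentralBond (P := P) k)} | b'.1 ∈ (combSet k : Set (PBond P 0))}}).lie := borel _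
  haveI : BorelSpace (piLogChart C {b : {b : PBond P 0 // b ∉ Set.range (iterCentralBond (P := P) k)} //
      b ∉ {b' : {b : PBond P 0 // b ∉ Set.range (iterCentralBond (P := P) k)} | b'.1 ∈ (combSet k : Set (PBond P 0))}}).lie := ⟨rfl⟩
  -- the off-pivot tree gauge
  set ext : ({b : PBond P 0 // b ∉ Set.range (iterCentralBond (P := P) k)} → G) → GaugeField P 0 G :=
    fun V' b => if hb : b ∈ Set.range (iterCentralBond (P := P) k) then (1 : G) else V' ⟨b, hb⟩ with hext
  set g : ({b : PBond P 0 // b ∉ Set.range (iterCentralBond (P := P) k)} → G) → (Site P 0 → G) :=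
    fun V' x => combTransporter k (ext V') x with hg
  have hext1 : ext (fun _ => 1) = 1 := by
    funext b
    show (if hb : b ∈ Set.range (iterCentralBond (P := P) k) then (1 : G) else 1) = 1
    split <;> rfl
  -- the six axioms
  have hgc : Continuous g := by
    have hextc : Continuous ext := by
      refine continuous_pi fun b => ?_
      by_cases hb : b ∈ Set.range (iterCentralBond (P := P) k)
      · simp only [hext, dif_pos hb]; exact continuous_const
      · simp only [hext, dif_neg hb]; exact continuous_apply _
    exact (continuous_combTransporter (P := P) (G := G) k).comp hextc
  have hgR : ∀ V', ∀ r ∈ Set.range (embIter k : Site P k → Site P 0), g V' r = 1 := by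
    rintro V' r ⟨y, rfl⟩
    exact combTransporter_embIter hk _ y
  have hcov : ∀ (a : Site P 0 → G), (∀ r ∈ Set.range (embIter k : Site P k → Site P 0), a r = 1) →
      ∀ (V' : {b : PBond P 0 // b ∉ Set.range (iterCentralBond (P := P) k)} → G) (x : Site P 0),
      g (fun b => a b.1.src * V' b * (a b.1.tgt)⁻¹) x = g V' x * (a x)⁻¹ := by
    intro a ha V' x
    have hroot : ∀ y : Site P k, a (embIter k y) = 1 := fun y => ha _ ⟨y, rfl⟩
    show combTransporter k (ext fun b => a b.1.src * V' b * (a b.1.tgt)⁻¹) x = combTransporter k (ext V') x * (a x)⁻¹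
    rw [← combTransporter_gaugeAct_of_rootTrivial k hroot (ext V') x,
      combTransporter_congr hk (ext_gauge_eq_on_combSet P hk a V')]
  have hkill : ∀ V', ∀ b ∈ {b' : {b : PBond P 0 // b ∉ Set.range (iterCentralBond (P := P) k)} | b'.1 ∈ (combSet k : Set (PBond P 0))},
      g V' b.1.src * V' b * (g V' b.1.tgt)⁻¹ = 1 := by
    intro V' b hb
    have := combTransporter_kill hk (ext V') hb
    rwa [show ext V' b.1 = V' b by simp only [hext, dif_neg b.2]] at this
  have hloc : ∀ V' V'' : {b : PBond P 0 // b ∉ Set.range (iterCentralBond (P := P) k)} → G,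
      (∀ b ∈ {b' : {b : PBond P 0 // b ∉ Set.range (iterCentralBond (P := P) k)} | b'.1 ∈ (combSet k : Set (PBond P 0))}, V' b = V'' b) →
      g V' = g V'' := by
    intro V' V'' hVV
    have hE : ∀ b ∈ (combSet k : Set (PBond P 0)), ext V' b = ext V'' b := by
      intro b hbF
      have hb : b ∉ Set.range (iterCentralBond (P := P) k) := fun ⟨c, hc⟩ => iterCentralBond_not_mem_combSet hk c (hc ▸ hbF)
      simp only [hext, dif_neg hb]
      exact hVV ⟨b, hb⟩ hbF
    funext x
    exact congrFun (combTransporter_congr hk hE) x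
  have hg1 : g (fun _ => 1) = fun _ => 1 := by
    funext x
    show combTransporter k (ext fun _ => 1) x = 1
    rw [hext1, combTransporter_one]
  exact exists_tubularChart_of_treeGauge h hlie μG (fun b : {b : PBond P 0 // b ∉ Set.range (iterCentralBond (P := P) k)} => b.1.src)
    (fun b => b.1.tgt) (Set.range (embIter k : Site P k → Site P 0))
    {b' : {b : PBond P 0 // b ∉ Set.range (iterCentralBond (P := P) k)} | b'.1 ∈ (combSet k : Set (PBond P 0))} g eZ eV
    hgc hgR hcov hkill hloc hg1 U₀

end Summit.QuantumFields.YangMills.Theorems.FluctuationComparisonRegPrIntLS2BetaTreeGaugeOffPivot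

end
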